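import Summits.Ventures.Crystal3D.Theorems.StickyWulffConstantNoReconstructionGainCellFluxGlue
import HarnessLib

/-!
# CellFlux: the twelve-coordinated case of the local lemma from a code-covering bound

HONEST FRAMING. Part of the venture `Summits/Ventures/Crystal3D` (cell `crystal3d-full`), helper
`--supports` the crux `NoReconstructionGain` (stmt-Ventures-19144, route
`route-Ventures-StickyWulffConstant`).  Planner cf-p1 g15's CellFlux target `TwelveOfCovering a`
(`…CellFluxDefs`), proved for `a > 0` and registered by name:

`twelveOfCovering` — if every 12-point kissing code has covering radius `< arccos (1/(2a))`
(`TwelveCodeCovering c` for some `c > 1/(2a)`), then a twelve-coordinated ball of a unit packing has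
cell flux `τᵢ(ν) = 0` for the spheres of radius `a` (`κ = 1`), i.e. `LocalFluxBoundAt a 1 12`:
the top (bottom) point of `Cᵢ` over any lateral position is `xᵢ + a u` with `u` a unit vector, the
twelve contact directions form a kissing code, some contact direction `w = xⱼ − xᵢ` has
`⟪u, w⟫ ≥ c > 1/(2a)`, and then `‖xᵢ + a u − xⱼ‖² = a² + 1 − 2a⟪u, w⟫ < a²`: the point lies in the
open body `Cⱼ`.  So both free slabs of ball `i` are empty.

WHAT THIS IS NOT: the code-covering bound itself (`Q₁₂ < 47.67°`, numerics by cf-p1/eng, to be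
certified); the other coordinations; rung F-C1 not moved.
-/

noncomputable section

namespace Summit.Ventures.Crystal3D.Theorems

open Summit.Ventures.Crystal3D Finset MeasureTheory
open Summit.Ventures.Crystal3D.Cruxes.NoReconstructionGain.CellFlux
open scoped InnerProductSpace

/-- `⟪lateral ν c y, ν⟫ = 0` (`‖ν‖ = 1`). -/
theorem inner_lateral_self (ν c y : EuclideanSpace ℝ (Fin 3)) (hν : ‖ν‖ = 1) :
    ⟪lateral ν c y, ν⟫_ℝ = 0 := by
  unfold lateral
  rw [inner_sub_left, inner_smul_left, real_inner_self_eq_norm_sq, hν]; simp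

/-- `‖lateral ν c y + s ν‖² = lateralSq ν c y + s²` (`‖ν‖ = 1`). -/
theorem norm_sq_lateral_add_smul (ν c y : EuclideanSpace ℝ (Fin 3)) (hν : ‖ν‖ = 1) (s : ℝ) :
    ‖lateral ν c y + s • ν‖ ^ 2 = lateralSq ν c y + s ^ 2 := by
  have h0 := inner_lateral_self ν c y hν
  have hlat : ‖lateral ν c y‖ ^ 2 = lateralSq ν c y := by
    unfold lateral lateralSq
    rw [norm_sub_sq_real, inner_smul_right, real_inner_comm, norm_smul, Real.norm_eq_abs, hν,
      mul_one, sq_abs]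
    ring
  rw [norm_add_sq_real, inner_smul_right, h0, norm_smul, Real.norm_eq_abs, hν, mul_one, sq_abs,
    hlat]
  ring

/-- A boundary point `xᵢ + v` (`‖v‖ = a`) of the sphere `Cᵢ` lies in the open sphere `Cⱼ` of a
contact neighbour (`‖xⱼ − xᵢ‖ = 1`) as soon as `⟪v, xⱼ − xᵢ⟫ > 1/2` (`κ = 1`). -/
theorem inOpenBody_of_inner_gt (ν : EuclideanSpace ℝ (Fin 3)) (a : ℝ) (xi xj v : EuclideanSpace ℝ (Fin 3))
    (hv : ‖v‖ ^ 2 = a ^ 2) (hw : ‖xj - xi‖ = 1) (h : 1 / 2 < ⟪v, xj - xi⟫_ℝ) (ha : 0 < a) :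
    InOpenBody ν a 1 xj (xi + v) := by
  unfold InOpenBody lateralSq
  rw [one_mul, ← add_div, div_lt_one (by positivity)]
  have e : xi + v - xj = v - (xj - xi) := by abel
  rw [e, sub_add_cancel, norm_sub_sq_real, hv, hw]
  linarith

/-- **`TwelveOfCovering a`** (`a > 0`; cf-p1 g15 CellFlux target, registered by name). -/
theorem twelveOfCovering : ∀ a : ℝ, 0 < a →
    Summit.Ventures.Crystal3D.Cruxes.NoReconstructionGain.CellFlux.TwelveOfCovering a := by
  intro a ha hcov N x hx ν hν i hi
  classical
  obtain ⟨c, hc, hcov⟩ := hcov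
  -- the kissing code of the twelve contact directions
  set W := (contactNeighbors x i).image fun j => x j - x i with hW
  have hxinj : Function.Injective x := hx.injective
  have hWcard : W.card = 12 := by
    rw [hW, card_image_of_injective _ (fun j j' h => hxinj (sub_left_injective h))]
    exact hi
  have hWnorm : ∀ w ∈ W, ‖w‖ = 1 := by
    intro w hw
    obtain ⟨j, hj, rfl⟩ := mem_image.1 hw
    rw [← dist_eq_norm, dist_comm]; exact ((mem_contactNeighbors x).1 hj).2
  have hWsep : ∀ v ∈ W, ∀ w ∈ W, v ≠ w → 1 ≤ ‖v - w‖ := by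
    intro v hv w hw hvw
    obtain ⟨j, hj, rfl⟩ := mem_image.1 hv
    obtain ⟨j', hj', rfl⟩ := mem_image.1 hw
    rw [sub_sub_sub_cancel_right, ← dist_eq_norm]
    exact hx.one_le_dist fun h => hvw (by rw [h])
  -- a free boundary point in direction `u` is impossible
  have key : ∀ (y : EuclideanSpace ℝ (Fin 3)) (s : ℝ), lateralSq ν (x i) y ≤ a ^ 2 →
      s ^ 2 = a ^ 2 - lateralSq ν (x i) y →
      ¬ ∀ j, j ≠ i → ¬ InOpenBody ν a 1 (x j) (x i + (lateral ν (x i) y + s • ν)) := by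
    intro y s hL hs hfree
    set v := lateral ν (x i) y + s • ν with hv
    have hv2 : ‖v‖ ^ 2 = a ^ 2 := by rw [hv, norm_sq_lateral_add_smul ν (x i) y hν s, hs]; ring
    have hva : ‖v‖ = a := by
      have := abs_le_of_sq_le_sq' hv2.le ha.le
      nlinarith [norm_nonneg v, abs_nonneg a, sq_abs a, this.2, sq_nonneg (‖v‖ - a)]
    set u := a⁻¹ • v with hu
    have hunit : ‖u‖ = 1 := by
      rw [hu, norm_smul, Real.norm_eq_abs, abs_inv, abs_of_pos ha, hva, inv_mul_cancel₀ ha.ne']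
    obtain ⟨w, hwW, hcw⟩ := hcov W hWcard hWnorm hWsep u hunit
    obtain ⟨j, hj, rfl⟩ := mem_image.1 hwW
    have hji : j ≠ i := ((mem_contactNeighbors x).1 hj).1
    have hwn : ‖x j - x i‖ = 1 := hWnorm _ hwW
    have hinner : 1 / 2 < ⟪v, x j - x i⟫_ℝ := by
      have e : ⟪v, x j - x i⟫_ℝ = a * ⟪u, x j - x i⟫_ℝ := by
        rw [hu, real_inner_smul_left, ← mul_assoc, mul_inv_cancel₀ ha.ne', one_mul]
      rw [e]
      have h1 : 1 / (2 * a) < ⟪u, x j - x i⟫_ℝ := lt_of_lt_of_le hc hcw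
      rw [div_lt_iff₀ (by positivity)] at h1
      nlinarith [h1]
    exact hfree j hji (inOpenBody_of_inner_gt ν a (x i) (x j) v hv2 hwn hinner ha)
  have hU : upperFreeSlab ν a 1 x i = ∅ := by
    ext y
    simp only [Set.mem_empty_iff_false, iff_false]
    rintro ⟨hL, -, hfree⟩
    refine key y (Real.sqrt (a ^ 2 - lateralSq ν (x i) y)) hL (Real.sq_sqrt (by linarith)) ?_
    intro j hji
    have := hfree j hji
    unfold topPoint at this
    rwa [one_mul, add_assoc] at this
  have hL : lowerFreeSlab ν a 1 x i = ∅ := by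
    ext y
    simp only [Set.mem_empty_iff_false, iff_false]
    rintro ⟨hL, -, hfree⟩
    refine key y (-Real.sqrt (a ^ 2 - lateralSq ν (x i) y)) hL
      (by rw [neg_sq, Real.sq_sqrt (by linarith)]) ?_
    intro j hji
    have := hfree j hji
    unfold bottomPoint at this
    rwa [one_mul, add_sub_assoc, sub_eq_add_neg, ← neg_smul] at this
  unfold cellFlux
  rw [hU, hL, measure_empty, ENNReal.toReal_zero]
  push_cast
  linarith

end Summit.Ventures.Crystal3D.Theorems
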